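import Summits.NavierStokesRegularity.NavierStokesRegularity.Theorems.EulerZoomLiouvillePowerGaugeEulerLiouvilleBackwardVanishingGeneralRho
import Literature.Analysis.FluidPDE.ClassicalSuitable
import HarnessLib

/-!
# EEL′-class profiles emerge from local rest: backward vanishing in density (crux
# `TypeIliouvilleNoTypeII`, stmt-NavierStokesRegularity-0056; rigidity residual EEL′ of the
# pressure-free eternal split)

Helper file (theorems only), a bridge from the Euler-zoom route's stub-2 machinery (crux
`PowerGaugeEulerLiouville`, `vanishesBackward_of_gauge_of_nonneg`) to the NS-side residual EEL′.
The energy class of EEL′ — `A_ess(v; Q) ≤ I` and `E(∇v; Q) ≤ I` on ALL parabolic balls, `I < ∞` — is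
the power gauge with exponent `ρ = 0` at the origin, and for a smooth field the classical gradient is
a weak spatial gradient (`hasWeakSpatialGradientOn_of_contDiffOn`) and CKN's `sup`-form `A` is below
Albritton–Barker's `ess sup`-form (`cknA_le_cknAEss_of_continuous`).  Hence:

* `eternal_vanishesBackward` — for every jointly smooth `v` with `A_ess, E ≤ I ≠ ∞` on all parabolic
  balls centred on the time axis and every `R, ε > 0`,
  `|{τ ∈ (-a², 0) : ∫_{B_R} |v(τ)|² > ε}| / a² → 0` as `a → ∞`:
  the profile is `L²(B_R)`-small at a density-one set of past times.  (Neither the equation nor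
  divergence-freeness is used.)

For the residual core of EEL′ (extremal profiles with `|v(0,0)| = sup |v| > 0`) this says: the profile
is a RECURRENT BURST out of local rest — at most past times it is locally negligible, yet it attains
its global maximum at the origin.  WHAT THIS IS NOT: not NS; EEL′ stays OPEN. [folklore]
-/

noncomputable section

-- the summit and its single problem share the name `NavierStokesRegularity` (D-0017 nested layout)
set_option linter.dupNamespace false

open Set Function Filter Topology MeasureTheory Metric TopologicalSpace
open scoped NNReal ENNReal

namespace Summit.NavierStokesRegularity.NavierStokesRegularity.Theorems.TypeIliouvilleNoTypeII.TypeIIZoom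

open Literature.Analysis Literature.Analysis.FluidPDE
open Summit.NavierStokesRegularity.NavierStokesRegularity.Theorems.PowerGaugeEulerLiouville.Backward
  (vanishesBackward_of_gauge_of_nonneg)

variable {v : ℝ → EuclideanSpace ℝ (Fin 3) → EuclideanSpace ℝ (Fin 3)}

/-- **`sup ≤ ess sup` for the scaled energy of a jointly continuous field**: `cknA r z v ≤ cknAEss r z v`.
The slice energy `s ↦ ∫_{B_r} |v(s)|²` is lower semicontinuous (Fatou), so a value above the essential
supremum would persist on an open set of times of positive measure. [folklore] -/
theorem cknA_le_cknAEss_of_continuous (hcont : Continuous (uncurry v)) (r : ℝ)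
    (z : ℝ × EuclideanSpace ℝ (Fin 3)) : cknA r z v ≤ cknAEss r z v := by
  -- adapted from Theorems/SelfMixingDichotomyCoherentScaleExclusionTypeIRegime.lean
  unfold cknA cknAEss
  set I : Set ℝ := Ioo (z.1 - r ^ 2) z.1 with hI
  set Gf : ℝ → ℝ≥0∞ := fun s => ∫⁻ x in ball z.2 r, ‖v s x‖ₑ ^ 2 with hGf
  have hconst : (fun s => (ENNReal.ofReal r)⁻¹ * ∫⁻ x in ball z.2 r, ‖v s x‖ₑ ^ 2) =
      fun s => (ENNReal.ofReal r)⁻¹ * Gf s := rfl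
  rw [hconst, ENNReal.essSup_const_mul]
  refine iSup₂_le fun t ht => ?_
  set μ : Measure ℝ := volume.restrict I with hμ
  suffices key : Gf t ≤ essSup Gf μ from mul_le_mul' le_rfl key
  by_contra hlt
  push Not at hlt
  have htI : t ∈ I := ht
  have hmeas : ∀ s : ℝ, AEMeasurable (fun x => ‖v s x‖ₑ ^ 2) (volume.restrict (ball z.2 r)) :=
    fun s => ((hcont.comp (Continuous.prodMk_right s)).measurable.enorm.pow_const 2).aemeasurable
  have hFatou := lintegral_liminf_le' (μ := volume.restrict (ball z.2 r)) (u := 𝓝 t)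
    (fun s => hmeas s)
  have hpt : ∀ x, liminf (fun s : ℝ => ‖v s x‖ₑ ^ 2) (𝓝 t) = ‖v t x‖ₑ ^ 2 := by
    intro x
    refine Tendsto.liminf_eq ?_
    have h1 : Tendsto (fun s : ℝ => v s x) (𝓝 t) (𝓝 (v t x)) :=
      ((hcont.comp (continuous_id.prodMk continuous_const)).tendsto t)
    exact ENNReal.Tendsto.pow h1.enorm
  rw [lintegral_congr fun x => hpt x] at hFatou
  have hev : ∀ᶠ s : ℝ in 𝓝 t, essSup Gf μ < Gf s :=
    eventually_lt_of_lt_liminf (hlt.trans_le hFatou)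
  rw [Metric.eventually_nhds_iff] at hev
  obtain ⟨ε, hε, hball⟩ := hev
  have hpos : 0 < volume (ball t ε ∩ I) :=
    (isOpen_ball.inter isOpen_Ioo).measure_pos volume ⟨t, mem_ball_self hε, htI⟩
  have hnull : μ {s | essSup Gf μ < Gf s} = 0 := meas_essSup_lt
  have hsub : ball t ε ∩ I ⊆ {s | essSup Gf μ < Gf s} ∩ I := fun s hs => ⟨hball hs.1, hs.2⟩
  rw [hμ, Measure.restrict_apply' measurableSet_Ioo] at hnull
  exact hpos.ne' (measure_mono_null hsub hnull)

/-- **EEL′-class profiles vanish backward in density.**  Let `v : ℝ × ℝ³ → ℝ³` be jointly smooth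
with `A_ess(v; Q_a(0,0)) ≤ I` and `E(∇v; Q_a(0,0)) ≤ I` for all `a > 0`, `I ≠ ∞`.  Then for every
`R, ε > 0` the proportion of times `τ ∈ (-a², 0)` with `∫_{B(0,R)} |v(τ)|² > ε` tends to `0` as
`a → ∞` (the Euler-zoom stub-2 mechanism at exponent `ρ = 0`). [folklore] -/
theorem eternal_vanishesBackward (hv : ContDiff ℝ (⊤ : ℕ∞) (uncurry v)) {I : ℝ≥0∞} (hI : I ≠ ⊤)
    (hA : ∀ a : ℝ, 0 < a → cknAEss a (0 : ℝ × EuclideanSpace ℝ (Fin 3)) v ≤ I)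
    (hE : ∀ a : ℝ, 0 < a →
      cknE a (0 : ℝ × EuclideanSpace ℝ (Fin 3)) (fun s y => fderiv ℝ (v s) y) ≤ I)
    {R ε : ℝ} (hR : 0 < R) (hε : 0 < ε) :
    Tendsto (fun a : ℝ =>
        volume {τ : ℝ | τ ∈ Set.Ioo (-(a ^ 2)) 0 ∧
            ENNReal.ofReal ε < ∫⁻ y in ball (0 : EuclideanSpace ℝ (Fin 3)) R, ‖v τ y‖ₑ ^ 2} /
          ENNReal.ofReal (a ^ 2))
      atTop (𝓝 0) := by
  -- the classical gradient is a weak spatial gradient on the slab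
  have hH : HasWeakSpatialGradientOn (slab (EuclideanSpace ℝ (Fin 3)) (Set.Iio 0) isOpen_Iio) v
      (fun s y => fderiv ℝ (v s) y) :=
    hasWeakSpatialGradientOn_of_contDiffOn isOpen_Iio (fun z hz => hz)
      ((hv.of_le (by exact_mod_cast le_top)).contDiffOn)
  -- the gauges with exponent `0` and constant `I.toNNReal`
  have hIc : ((I.toNNReal : ℝ≥0) : ℝ≥0∞) = I := ENNReal.coe_toNNReal hI
  have hA' : ∀ a : ℝ, 0 < a → ENNReal.ofReal (a ^ (2 * (0 : ℝ))) *
      cknA a (0 : ℝ × EuclideanSpace ℝ (Fin 3)) v ≤ ((I.toNNReal : ℝ≥0) : ℝ≥0∞) := by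
    intro a ha
    rw [mul_zero, Real.rpow_zero, ENNReal.ofReal_one, one_mul, hIc]
    exact (cknA_le_cknAEss_of_continuous hv.continuous a 0).trans (hA a ha)
  have hE' : ∀ a : ℝ, 0 < a → ENNReal.ofReal (a ^ (0 : ℝ)) *
      cknE a (0 : ℝ × EuclideanSpace ℝ (Fin 3)) (fun s y => fderiv ℝ (v s) y) ≤
        ((I.toNNReal : ℝ≥0) : ℝ≥0∞) := by
    intro a ha
    rw [Real.rpow_zero, ENNReal.ofReal_one, one_mul, hIc]
    exact hE a ha
  exact vanishesBackward_of_gauge_of_nonneg le_rfl hH hA' hE' hR hε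

end Summit.NavierStokesRegularity.NavierStokesRegularity.Theorems.TypeIliouvilleNoTypeII.TypeIIZoom

end
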